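import Summits.QuantumFields.GaugeBoot.PlanarLoopDataZd
import Summits.QuantumFields.GaugeBoot.ZdLoopEquationStates
import HarnessLib

/-!
# The planar Makeenko–Migdal rows read at finite `N` on `ℤ^d`: exact for `U(N)`, imaginary-part covariances + `1/N²` for `SU(N)` (gauge-boot, large-`N` supplement 3)

HONEST FRAMING (cell `pub-gaugeboot`, page 1 of every file): the venture produces certified bounds
on lattice expectations at stated coupling, gauge group, dimension and torus size; NOT a mass gap,
NOT a continuum limit, NOT a string tension; NOT large `N` unless marked CONDITIONAL; NOT
Yang–Mills-summit-bearing (barriers `FixedCouplingUltralocality`, `PerturbativeInvisibility`).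
This file proves which identities the finite-`N` states satisfy; it certifies no number.

## Content

Kazakov–Zheng's planar loop equation of a marked closed word `w` at the link `(x, a)`
(arXiv:2203.11360 §2, 't Hooft coupling; in the tree's normalisation the plaquette coefficient is
`βt/2` with `βt = β/N`, `β` the tree coupling) is, after the relaxation `W[A] W[B] ↦ Q(A, B)`, the
AFFINE functional of planar data `(W, Q)`

`planarRow βt a w W Q = Σ_{k ∈ fwdOcc} Q(w[0,k), w[k,n)) − Σ_{k ∈ bwdOcc} Q(w[0,k], w(k,n))`
`                      + (βt/2) Σ_{ν ≠ a} Σ_ε (W(w·P̃_{ν,ε}) − W(w·P̃_{ν,ε}⁻¹))`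

(occurrence sets `Word.fwdOccZ/bwdOccZ` of `LoopEquationSchema`, plaquette words `plaqWord`).  Read on
the planar data of a STATE `μ` on `ℤ^d` (`PlanarLoopDataZd`: `W = loopW`, `Q = loopQ` = pair
expectations), the tree's finite-`N` loop equations (`ZdLoopEquationStates`) say:

* ★★★ `planarRow_loopData_uN` — **`U(N)`, EVERY `N`, every real `β`, every Haar-shift state (DLR
  states, torus limit points, Class B): the planar row holds EXACTLY**, `planarRow (β/N) a w W Q = 0`.
* ★★★ `planarRow_loopData_suN` — **`SU(N)`: `planarRow (β/N) a w W Q = ((#fwd − #bwd)/N²) W(w)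
  − (β/N) Σ_{ν ≠ a} Σ_ε Γ(w, P̃_{ν,ε})`** with `Γ = loopImCov` the imaginary-part covariance
  (`Q(w, P̃) − Q(w, P̃⁻¹) = −2 Γ(w, P̃)`); ★★ `abs_planarRow_loopData_suN_le`:
  `|planarRow| ≤ length(w)/N² + |β/N| · Σ_{ν ≠ a} Σ_ε |Γ(w, P̃_{ν,ε})|`.
* Corollaries for DLR states and torus limit points (`…_of_mem_ymGibbsMeasures`,
  `…_of_mem_infiniteVolumeLimitPoints`).

So the ONLY deviations of a finite-`N` state from the planar (factorised, relaxed) loop equations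
are: nothing for `U(N)`; for `SU(N)`, `O(length/N²)` plus imaginary-part covariances — both sent to
zero by large-`N` factorisation.  [folklore]: Makeenko–Migdal 1979; Kazakov–Zheng arXiv:2203.11360
§2; Anderson–Kruczenski Nucl. Phys. B 921 (2017) §2; the finite-`N` rows are the tree's.
-/

noncomputable section

open MeasureTheory
open scoped BigOperators
open Literature.Probability.LatticeModels (Site)
open Literature.MathematicalPhysics.QuantumLattice

namespace Summit.QuantumFields.GaugeBoot

variable {d N : ℕ}

/-! ## The planar row as an affine functional of planar data -/

/-- **Kazakov–Zheng's planar loop equation of the marked word `w` at the link `(x, a)`, relaxed**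
(`W[A] W[B] ↦ Q(A, B)`), as an affine functional of planar data `(W, Q)` on words based at `x`;
`βt` is the 't Hooft-normalised coupling (`β/N` for the tree coupling `β`). [cite: KazakovZheng2023, §2] -/
def planarRow (βt : ℝ) (a : Fin d) (w : Word d) (W : Word d → ℝ) (Q : Word d → Word d → ℝ) : ℝ :=
  (∑ k ∈ (Finset.range w.length).filter (w.fwdOccZ a), Q (w.take k) (w.drop k)) -
    (∑ k ∈ (Finset.range w.length).filter (w.bwdOccZ a), Q (w.take (k + 1)) (w.drop (k + 1))) +
    βt / 2 * ∑ ν ∈ Finset.univ.erase a, ∑ ε : Bool, (W (w ++ plaqWord a ν ε) - W (w ++ (plaqWord a ν ε).reverse))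

/-- The planar row is affine: it splits as (pair part) + (βt/2)·(single-loop part). [folklore] -/
theorem planarRow_eq (βt : ℝ) (a : Fin d) (w : Word d) (W : Word d → ℝ) (Q : Word d → Word d → ℝ) :
    planarRow βt a w W Q =
      ((∑ k ∈ (Finset.range w.length).filter (w.fwdOccZ a), Q (w.take k) (w.drop k)) -
        ∑ k ∈ (Finset.range w.length).filter (w.bwdOccZ a), Q (w.take (k + 1)) (w.drop (k + 1))) +
      βt / 2 * ∑ ν ∈ Finset.univ.erase a, ∑ ε : Bool,
        (W (w ++ plaqWord a ν ε) - W (w ++ (plaqWord a ν ε).reverse)) := rfl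

/-- The re-oriented plaquette words are closed on `ℤ^d` (as `ZdLoopEquationSU2.Word.endpointZd_plaqWord`). [folklore] -/
private theorem endpointZd_plaqWord' (x : Site d) (a ν : Fin d) (ε : Bool) :
    Word.endpointZd x (plaqWord a ν ε) = x := by
  rw [← TiltedRP.endpoint_zdUnit, TiltedRP.endpoint_plaqWord]

/-! ## Dictionary: the tree's written-out variables are `loopW` / `loopQ` -/

section Dictionary

variable {G : Type*} [Group G] [TopologicalSpace G] [IsTopologicalGroup G] [CompactSpace G]
  [MeasurableSpace G] [BorelSpace G] (ρ : G →* Matrix (Fin N) (Fin N) ℂ)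

omit [TopologicalSpace G] [IsTopologicalGroup G] [CompactSpace G] [BorelSpace G] in
/-- `(1/N) Re ∫ tr ρ(hol C) dμ = W(C)`. [folklore] -/
theorem inv_mul_re_integral_trace_eq_loopW (μ : Measure (LGConfig d G)) (x : Site d) (C : Word d) :
    (N : ℝ)⁻¹ * (∫ U, (ρ (wordHolonomyZd U x C)).trace ∂μ).re = loopW ρ μ x C := by
  rw [loopW]
  simp only [loopTrZd_apply]
  rw [integral_div, Complex.div_natCast_re, div_eq_inv_mul]

omit [TopologicalSpace G] [IsTopologicalGroup G] [CompactSpace G] [BorelSpace G] in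
/-- `Re ∫ tr ρ(hol A) tr ρ(hol B) dμ / N² = Q(A, B)`. [folklore] -/
theorem re_integral_trace_mul_trace_div_eq_loopQ (μ : Measure (LGConfig d G)) (x : Site d) (A B : Word d) :
    (∫ U, (ρ (wordHolonomyZd U x A)).trace * (ρ (wordHolonomyZd U x B)).trace ∂μ).re / (N : ℝ) ^ 2 =
      loopQ ρ μ x A B := by
  rw [loopQ]
  simp only [loopTrZd_apply]
  have h : ∀ U : LGConfig d G, (ρ (wordHolonomyZd U x A)).trace / (N : ℂ) * ((ρ (wordHolonomyZd U x B)).trace / (N : ℂ)) =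
      (ρ (wordHolonomyZd U x A)).trace * (ρ (wordHolonomyZd U x B)).trace / ((N ^ 2 : ℕ) : ℂ) := fun U => by
    push_cast; ring
  simp_rw [h]
  rw [integral_div, Complex.div_natCast_re]
  push_cast
  rfl

end Dictionary

/-! ## `U(N)`: the planar rows are exact at every `N` -/

section Unitary

/-- ★★★ **THE PLANAR LOOP EQUATIONS HOLD EXACTLY FOR `U(N)` AT EVERY `N`** when the products
`W[A] W[B]` are read as pair expectations: for every real `β`, every finite Haar-shift state `μ` of
the `U(N)` Wilson action on `ℤ^d` (every DLR state, torus limit point, Class-B state), every marked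
closed word: `planarRow (β/N) a w (loopW μ) (loopQ μ) = 0`. [folklore] -/
theorem planarRow_loopData_uN {β : ℝ} {μ : Measure (LGConfig d (Matrix.unitaryGroup (Fin N) ℂ))} [IsFiniteMeasure μ]
    (hμ : IsHaarShiftState (unitaryFundamentalRep (Fin N) ℂ) β μ) (x : Site d) (a : Fin d) (w : Word d)
    (hw : Word.endpointZd x w = x) :
    planarRow (β / N) a w (loopW (unitaryFundamentalRep (Fin N) ℂ) μ x) (loopQ (unitaryFundamentalRep (Fin N) ℂ) μ x) = 0 := by
  have h := hμ.loopEquation_pairForm_uN x a w hw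
  simp only [re_integral_trace_mul_trace_div_eq_loopQ, inv_mul_re_integral_trace_eq_loopW] at h
  rw [planarRow, ← h]
  congr 1
  ring

/-- The same for every infinite-volume DLR state of `U(N)` lattice Yang–Mills. [folklore] -/
theorem planarRow_loopData_uN_of_mem_ymGibbsMeasures {β : ℝ} {μ : Measure (LGConfig d (Matrix.unitaryGroup (Fin N) ℂ))}
    (hμ : μ ∈ ymGibbsMeasures (d := d) (unitaryFundamentalRep (Fin N) ℂ) β) (x : Site d) (a : Fin d) (w : Word d)
    (hw : Word.endpointZd x w = x) :
    planarRow (β / N) a w (loopW (unitaryFundamentalRep (Fin N) ℂ) μ x) (loopQ (unitaryFundamentalRep (Fin N) ℂ) μ x) = 0 := by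
  haveI : SecondCountableTopology (Matrix (Fin N) (Fin N) ℂ) :=
    inferInstanceAs (SecondCountableTopology (Fin N → Fin N → ℂ))
  haveI : SecondCountableTopology (Matrix.unitaryGroup (Fin N) ℂ) :=
    Topology.IsEmbedding.subtypeVal.secondCountableTopology
  haveI : IsProbabilityMeasure μ := hμ.1
  exact planarRow_loopData_uN (isHaarShiftState_of_mem_ymGibbsMeasures (unitaryFundamentalRep (Fin N) ℂ)
    (continuous_unitaryFundamentalRep (Fin N) ℂ) hμ) x a w hw

/-- The same for every infinite-volume limit point of the `U(N)` torus Wilson states. [folklore] -/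
theorem planarRow_loopData_uN_of_mem_infiniteVolumeLimitPoints {β : ℝ}
    {μ : Measure (LGConfig d (Matrix.unitaryGroup (Fin N) ℂ))}
    (hμ : μ ∈ infiniteVolumeLimitPoints (d := d) (unitaryFundamentalRep (Fin N) ℂ) β) (x : Site d) (a : Fin d)
    (w : Word d) (hw : Word.endpointZd x w = x) :
    planarRow (β / N) a w (loopW (unitaryFundamentalRep (Fin N) ℂ) μ x) (loopQ (unitaryFundamentalRep (Fin N) ℂ) μ x) = 0 := by
  haveI : SecondCountableTopology (Matrix (Fin N) (Fin N) ℂ) :=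
    inferInstanceAs (SecondCountableTopology (Fin N → Fin N → ℂ))
  haveI : SecondCountableTopology (Matrix.unitaryGroup (Fin N) ℂ) :=
    Topology.IsEmbedding.subtypeVal.secondCountableTopology
  exact planarRow_loopData_uN_of_mem_ymGibbsMeasures
    (mem_ymGibbsMeasures_of_mem_infiniteVolumeLimitPoints_holds (unitaryFundamentalRep (Fin N) ℂ)
      (continuous_unitaryFundamentalRep (Fin N) ℂ) hμ) x a w hw

end Unitary

/-! ## `SU(N)`: the planar rows hold up to `1/N²` and imaginary-part covariances -/

section SpecialUnitary

/-- ★★★ **THE PLANAR LOOP EQUATIONS AT FINITE `N` FOR `SU(N)`**: for every real `β`, every finite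
Haar-shift state `μ` of the `SU(N)` Wilson action on `ℤ^d`, every marked closed word `w`,
`planarRow (β/N) a w W Q = ((#fwdOcc − #bwdOcc)/N²)·W(w) − (β/N)·Σ_{ν ≠ a} Σ_ε Γ(w, P̃_{ν,ε})`
— the traceless (`1/N`) terms of the `𝔰𝔲(N)` completeness relation and the pair plaquette terms
`Q(w, P̃) − Q(w, P̃⁻¹) = −2 E[Im t_w Im t_{P̃}]`. [folklore] -/
theorem planarRow_loopData_suN {β : ℝ} {μ : Measure (LGConfig d (Matrix.specialUnitaryGroup (Fin N) ℂ))}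
    [IsFiniteMeasure μ] (hμ : IsHaarShiftState (fundamentalRep (Fin N)) β μ) (x : Site d) (a : Fin d) (w : Word d)
    (hw : Word.endpointZd x w = x) :
    planarRow (β / N) a w (loopW (fundamentalRep (Fin N)) μ x) (loopQ (fundamentalRep (Fin N)) μ x) =
      ((((Finset.range w.length).filter (w.fwdOccZ a)).card : ℝ) - ((Finset.range w.length).filter (w.bwdOccZ a)).card) /
          (N : ℝ) ^ 2 * loopW (fundamentalRep (Fin N)) μ x w -
        β / N * ∑ ν ∈ Finset.univ.erase a, ∑ ε : Bool, loopImCov (fundamentalRep (Fin N)) μ x w (plaqWord a ν ε) := by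
  have h := hμ.loopEquation_pairForm_suN x a w hw
  simp only [re_integral_trace_mul_trace_div_eq_loopQ, inv_mul_re_integral_trace_eq_loopW] at h
  -- the pair plaquette terms are `−2 Γ`
  have hP : ∀ ν ε, loopQ (fundamentalRep (Fin N)) μ x w (plaqWord a ν ε) -
      loopQ (fundamentalRep (Fin N)) μ x w (plaqWord a ν ε).reverse =
        -2 * loopImCov (fundamentalRep (Fin N)) μ x w (plaqWord a ν ε) := fun ν ε =>
    loopQ_sub_loopQ_reverse _ (continuous_fundamentalRep (Fin N)) μ x w (endpointZd_plaqWord' x a ν ε)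
  simp only [hP] at h
  -- atomise all sums on both sides
  simp only [Finset.sum_sub_distrib, Finset.sum_const, nsmul_eq_mul, ← Finset.mul_sum] at h
  rw [planarRow]
  simp only [Finset.sum_sub_distrib]
  linear_combination h

/-- ★★ **The size of the `SU(N)` defect**: `|planarRow| ≤ length(w)/N² + |β/N| · Σ_{ν ≠ a} Σ_ε |Γ(w, P̃)|`
(`|W| ≤ 1`, both occurrence sets inside `range (length w)`; probability states). [folklore] -/
theorem abs_planarRow_loopData_suN_le {β : ℝ} {μ : Measure (LGConfig d (Matrix.specialUnitaryGroup (Fin N) ℂ))}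
    [IsProbabilityMeasure μ] (hμ : IsHaarShiftState (fundamentalRep (Fin N)) β μ) (x : Site d) (a : Fin d) (w : Word d)
    (hw : Word.endpointZd x w = x) :
    |planarRow (β / N) a w (loopW (fundamentalRep (Fin N)) μ x) (loopQ (fundamentalRep (Fin N)) μ x)| ≤
      (w.length : ℝ) / (N : ℝ) ^ 2 +
        |β / N| * ∑ ν ∈ Finset.univ.erase a, ∑ ε : Bool, |loopImCov (fundamentalRep (Fin N)) μ x w (plaqWord a ν ε)| := by
  rw [planarRow_loopData_suN hμ x a w hw]
  have hW : |loopW (fundamentalRep (Fin N)) μ x w| ≤ 1 := abs_loopW_le_one _ (continuous_fundamentalRep (Fin N)) μ x w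
  -- the occurrence counts are at most `length w`
  have hcf : (((Finset.range w.length).filter (w.fwdOccZ a)).card : ℝ) ≤ w.length := by
    exact_mod_cast (Finset.card_filter_le _ _).trans (Finset.card_range _).le
  have hcb : (((Finset.range w.length).filter (w.bwdOccZ a)).card : ℝ) ≤ w.length := by
    exact_mod_cast (Finset.card_filter_le _ _).trans (Finset.card_range _).le
  have hdiff : |(((Finset.range w.length).filter (w.fwdOccZ a)).card : ℝ) -
      ((Finset.range w.length).filter (w.bwdOccZ a)).card| ≤ w.length := by
    rw [abs_sub_le_iff]
    constructor <;> linarith [Nat.cast_nonneg (α := ℝ) ((Finset.range w.length).filter (w.fwdOccZ a)).card,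
      Nat.cast_nonneg (α := ℝ) ((Finset.range w.length).filter (w.bwdOccZ a)).card]
  have h1 : |((((Finset.range w.length).filter (w.fwdOccZ a)).card : ℝ) -
      ((Finset.range w.length).filter (w.bwdOccZ a)).card) / (N : ℝ) ^ 2 * loopW (fundamentalRep (Fin N)) μ x w| ≤
      (w.length : ℝ) / (N : ℝ) ^ 2 := by
    rw [abs_mul, abs_div, abs_of_nonneg (by positivity : (0 : ℝ) ≤ (N : ℝ) ^ 2)]
    rcases Nat.eq_zero_or_pos N with hN | hN
    · subst hN; simp
    · have hN2 : (0 : ℝ) < (N : ℝ) ^ 2 := by positivity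
      calc _ ≤ (w.length : ℝ) / (N : ℝ) ^ 2 * 1 := by gcongr
        _ = _ := mul_one _
  have h2 : |β / N * ∑ ν ∈ Finset.univ.erase a, ∑ ε : Bool, loopImCov (fundamentalRep (Fin N)) μ x w (plaqWord a ν ε)| ≤
      |β / N| * ∑ ν ∈ Finset.univ.erase a, ∑ ε : Bool, |loopImCov (fundamentalRep (Fin N)) μ x w (plaqWord a ν ε)| := by
    rw [abs_mul]
    gcongr
    exact (Finset.abs_sum_le_sum_abs _ _).trans (Finset.sum_le_sum fun ν _ => Finset.abs_sum_le_sum_abs _ _)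
  exact (abs_sub _ _).trans (add_le_add h1 h2)

/-- The `SU(N)` planar rows for every infinite-volume DLR state. [folklore] -/
theorem abs_planarRow_loopData_suN_le_of_mem_ymGibbsMeasures {β : ℝ}
    {μ : Measure (LGConfig d (Matrix.specialUnitaryGroup (Fin N) ℂ))}
    (hμ : μ ∈ ymGibbsMeasures (d := d) (fundamentalRep (Fin N)) β) (x : Site d) (a : Fin d) (w : Word d)
    (hw : Word.endpointZd x w = x) :
    |planarRow (β / N) a w (loopW (fundamentalRep (Fin N)) μ x) (loopQ (fundamentalRep (Fin N)) μ x)| ≤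
      (w.length : ℝ) / (N : ℝ) ^ 2 +
        |β / N| * ∑ ν ∈ Finset.univ.erase a, ∑ ε : Bool, |loopImCov (fundamentalRep (Fin N)) μ x w (plaqWord a ν ε)| := by
  haveI : SecondCountableTopology (Matrix (Fin N) (Fin N) ℂ) :=
    inferInstanceAs (SecondCountableTopology (Fin N → Fin N → ℂ))
  haveI : SecondCountableTopology (Matrix.specialUnitaryGroup (Fin N) ℂ) :=
    Topology.IsEmbedding.subtypeVal.secondCountableTopology
  haveI : IsProbabilityMeasure μ := hμ.1
  exact abs_planarRow_loopData_suN_le (isHaarShiftState_of_mem_ymGibbsMeasures (fundamentalRep (Fin N))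
    (continuous_fundamentalRep (Fin N)) hμ) x a w hw

/-- The `SU(N)` planar rows for every infinite-volume limit point of the torus Wilson states. [folklore] -/
theorem abs_planarRow_loopData_suN_le_of_mem_infiniteVolumeLimitPoints {β : ℝ}
    {μ : Measure (LGConfig d (Matrix.specialUnitaryGroup (Fin N) ℂ))}
    (hμ : μ ∈ infiniteVolumeLimitPoints (d := d) (fundamentalRep (Fin N)) β) (x : Site d) (a : Fin d) (w : Word d)
    (hw : Word.endpointZd x w = x) :
    |planarRow (β / N) a w (loopW (fundamentalRep (Fin N)) μ x) (loopQ (fundamentalRep (Fin N)) μ x)| ≤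
      (w.length : ℝ) / (N : ℝ) ^ 2 +
        |β / N| * ∑ ν ∈ Finset.univ.erase a, ∑ ε : Bool, |loopImCov (fundamentalRep (Fin N)) μ x w (plaqWord a ν ε)| := by
  haveI : SecondCountableTopology (Matrix (Fin N) (Fin N) ℂ) :=
    inferInstanceAs (SecondCountableTopology (Fin N → Fin N → ℂ))
  haveI : SecondCountableTopology (Matrix.specialUnitaryGroup (Fin N) ℂ) :=
    Topology.IsEmbedding.subtypeVal.secondCountableTopology
  exact abs_planarRow_loopData_suN_le_of_mem_ymGibbsMeasures
    (mem_ymGibbsMeasures_of_mem_infiniteVolumeLimitPoints_holds (fundamentalRep (Fin N))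
      (continuous_fundamentalRep (Fin N)) hμ) x a w hw

end SpecialUnitary

end Summit.QuantumFields.GaugeBoot

end
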